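import Mathlib
import HarnessLib
import Summits.Ventures.LatticeQCDFlow.Exactness.SphereIndependenceSamplerSignTauInt
import Summits.Ventures.LatticeQCDFlow.Exactness.SphereIndependenceSamplerEventTauInt
import Summits.Ventures.LatticeQCDFlow.Exactness.SphereLOFlowEffectiveAction
import Summits.Ventures.LatticeQCDFlow.Exactness.SphereLOFlowEffectiveActionConcentration

/-!
# The integrated autocorrelation time of balanced sign observables of the exact leading-order flow sampler: `∫w²/(∫w)² − ½ ≤ τ_int ≤ ½ + 12·∫w²/(∫w)²` for every E–S coupling, hence `τ_int ≤ ½ + 12·e^{(c²/2)M}` — finite in every volume, of order one for `c²M = O(1)`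

HONEST FRAMING: exact (Metropolis-corrected) sampling algorithms for lattice gauge theory;
figures of merit are autocorrelation/cost numbers at stated couplings and volumes; no
continuum-physics claim.

Venture `LatticeQCDFlow` (cell pub-lqcd), topic `Exactness`; FANOUT row 7 (`s0-cpn-null`: the S0-D1
rung — 2D CP⁹, Lüscher's LO trivializing map inside HMC, Engel–Schaefer 2011).  NEW WORK of the cell
over this lineage's `Exactness/SphereIndependenceSamplerSignTauInt.lean` (the bridge to row 2's
sign-observable sandwich `1/κ − ½ ≤ τ_int ≤ ½ + 12/κ` on the lattice of spheres) and GEN-15's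
`Exactness/SphereLOFlowEffectiveAction.lean` (`sq_integral_loWeight_ge`: the effective-sample-size
floor `exp(−(c²/2)M)·∫w² ≤ (∫w)²`, `M = (2κ²/(d−1))Σ_n(Σ_m‖U_nm‖)²`, for the weights
`w = exp(ℓ_{0→c} − c·S∘Φ_{0→c})` of the uncorrected exact LO flow sampler), with
`Exactness/SphereLOFlowEffectiveActionConcentration.lean` (continuity of `S_eff`); nothing is cited as
a fact.  Printed counterparts, NAMED ONLY: Albergo–Kanwar–Shanahan 2019 §II; Madras–Sokal 1988 /
Wolff 2004; Engel–Schaefer 2011 §3.  THE TWO-SIDED STATEMENT FOR THE FIGURE OF MERIT.  For the exact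
leading-order trivializing flow sampler of the lattice CP(N−1)/O(N) action (E–S coupling: no
self-coupling, adjoint pairs, `d ≥ 2`, `0 ≤ c ≤ |T| + 1`; target `π̄.tilted(−S_eff)`,
`S_eff = c·S∘Φ_{0→c} − ℓ_{0→c}`, proposal `π̄`, Metropolis-corrected) and every balanced sign
observable `g` (`g² = 1`, `∫ g e^{−S_eff} dπ̄ = 0`):
`∫w² dπ̄/(∫w dπ̄)² − ½ ≤ τ_int(g) ≤ ½ + 12·∫w² dπ̄/(∫w dπ̄)²` — for THIS sampler the integrated
autocorrelation time of balanced sign observables IS the inverse effective-sample-size fraction of the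
raw importance sampler up to the constants `(1, 12)` and `½`; consequently (GEN-15's floor)
`τ_int(g) ≤ ½ + 12·exp((c²/2)M)`: finite in every volume, at most exponential in the volume at fixed
flow time (matching the exponential FLOOR of the sequel `TorusLinkSignObservableTauInt` for the model
of record), and of order one in the window `c²M = O(1)`.

## Content

* **`loFlow_sign_tauInt_sandwich`** — the two-sided bound by `∫w²/(∫w)²`;
* **`loFlow_sign_tauInt_le`** — `τ_int(g) ≤ ½ + 12·exp((c²/2)·(2κ²/(d−1))Σ_n(Σ_m‖U_nm‖)²)`;
* **`loFlow_event_tauInt_le`** — for every event `A` of target probability `p ∈ (0,1)`: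
  `τ_int(1_A) ≤ ½ + 12·(p∨(1−p))/(p∧(1−p))·exp((c²/2)·(2κ²/(d−1))Σ_n(Σ_m‖U_nm‖)²)` (this lineage's
  `SphereIndependenceSamplerEventTauInt`).

NOT CLAIMED: observables with non-constant `g²`; the rung's HMC-inside-the-map algorithm; numbers.
-/

noncomputable section

namespace Summit.Ventures.LatticeQCDFlow.Exactness

open Function Set Metric MeasureTheory NormedSpace InnerProductSpace
open Summit.Ventures.LatticeQCDFlow.Scoring
open scoped RealInnerProductSpace Topology

section LO

variable {Λ : Type*} {E : Type*} [NormedAddCommGroup E] [InnerProductSpace ℝ E]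
  [FiniteDimensional ℝ E] [Fintype Λ] [DecidableEq Λ] [MeasurableSpace E] [BorelSpace E] [Nontrivial E]
  {U : Λ → Λ → (E →L[ℝ] E)} {T : ℝ}

/-- **THE SIGN-OBSERVABLE SANDWICH FOR THE EXACT LEADING-ORDER FLOW SAMPLER** (any E–S coupling,
`0 ≤ c ≤ |T| + 1`): for every measurable `g` with `g² = 1` and `∫ g e^{−S_eff} dπ̄ = 0`,
`∫e^{−2S_eff}dπ̄/(∫e^{−S_eff}dπ̄)² − ½ ≤ τ_int(g) ≤ ½ + 12·∫e^{−2S_eff}dπ̄/(∫e^{−S_eff}dπ̄)²`. -/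
theorem loFlow_sign_tauInt_sandwich (κ S₀ c : ℝ)
    {g : (Λ → sphere (0 : E) 1) → ℝ} (hgm : Measurable g) (hg1 : ∀ ω, g ω ^ 2 = 1)
    (hg0 : ∫ ω, g ω * Real.exp (-(c * esAction κ S₀ U (sphereTDFlow (G := fun _ : ℝ => loFlowAction κ S₀ U)
            (contDiff_const_family (contDiff_loFlowAction U κ S₀)) T 0 c (fun m => ((ω : Λ → sphere (0 : E) 1) m : E))) -
          sphereTDFlowLogJac (G := fun _ : ℝ => loFlowAction κ S₀ U)
            (contDiff_const_family (contDiff_loFlowAction U κ S₀)) T 0 c (fun m => (ω m : E)))) ∂Measure.pi (fun _ : Λ => uniformSphere (volume : Measure E)) = 0) :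
    (∫ ω, Real.exp (-2 * (c * esAction κ S₀ U (sphereTDFlow (G := fun _ : ℝ => loFlowAction κ S₀ U)
            (contDiff_const_family (contDiff_loFlowAction U κ S₀)) T 0 c (fun m => ((ω : Λ → sphere (0 : E) 1) m : E))) -
          sphereTDFlowLogJac (G := fun _ : ℝ => loFlowAction κ S₀ U)
            (contDiff_const_family (contDiff_loFlowAction U κ S₀)) T 0 c (fun m => (ω m : E)))) ∂Measure.pi (fun _ : Λ => uniformSphere (volume : Measure E))) /
          (∫ ω, Real.exp (-(c * esAction κ S₀ U (sphereTDFlow (G := fun _ : ℝ => loFlowAction κ S₀ U)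
            (contDiff_const_family (contDiff_loFlowAction U κ S₀)) T 0 c (fun m => ((ω : Λ → sphere (0 : E) 1) m : E))) -
          sphereTDFlowLogJac (G := fun _ : ℝ => loFlowAction κ S₀ U)
            (contDiff_const_family (contDiff_loFlowAction U κ S₀)) T 0 c (fun m => (ω m : E)))) ∂Measure.pi (fun _ : Λ => uniformSphere (volume : Measure E))) ^ 2 - 1 / 2 ≤
      tauInt (fun k => (∫ ω, g ω *
          ((imhOp (Measure.pi (fun _ : Λ => uniformSphere (volume : Measure E))) (fun η => Real.exp (-(c * esAction κ S₀ U (sphereTDFlow (G := fun _ : ℝ => loFlowAction κ S₀ U)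
            (contDiff_const_family (contDiff_loFlowAction U κ S₀)) T 0 c (fun m => ((η : Λ → sphere (0 : E) 1) m : E))) -
          sphereTDFlowLogJac (G := fun _ : ℝ => loFlowAction κ S₀ U)
            (contDiff_const_family (contDiff_loFlowAction U κ S₀)) T 0 c (fun m => (η m : E)))))
            (fun _ => (1 : ℝ)))^[k] g) ω * Real.exp (-(c * esAction κ S₀ U (sphereTDFlow (G := fun _ : ℝ => loFlowAction κ S₀ U)
            (contDiff_const_family (contDiff_loFlowAction U κ S₀)) T 0 c (fun m => ((ω : Λ → sphere (0 : E) 1) m : E))) -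
          sphereTDFlowLogJac (G := fun _ : ℝ => loFlowAction κ S₀ U)
            (contDiff_const_family (contDiff_loFlowAction U κ S₀)) T 0 c (fun m => (ω m : E))))
            ∂Measure.pi (fun _ : Λ => uniformSphere (volume : Measure E))) /
          ∫ ω, g ω ^ 2 * Real.exp (-(c * esAction κ S₀ U (sphereTDFlow (G := fun _ : ℝ => loFlowAction κ S₀ U)
            (contDiff_const_family (contDiff_loFlowAction U κ S₀)) T 0 c (fun m => ((ω : Λ → sphere (0 : E) 1) m : E))) -
          sphereTDFlowLogJac (G := fun _ : ℝ => loFlowAction κ S₀ U)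
            (contDiff_const_family (contDiff_loFlowAction U κ S₀)) T 0 c (fun m => (ω m : E)))) ∂Measure.pi (fun _ : Λ => uniformSphere (volume : Measure E))) ∧
    tauInt (fun k => (∫ ω, g ω *
          ((imhOp (Measure.pi (fun _ : Λ => uniformSphere (volume : Measure E))) (fun η => Real.exp (-(c * esAction κ S₀ U (sphereTDFlow (G := fun _ : ℝ => loFlowAction κ S₀ U)
            (contDiff_const_family (contDiff_loFlowAction U κ S₀)) T 0 c (fun m => ((η : Λ → sphere (0 : E) 1) m : E))) -
          sphereTDFlowLogJac (G := fun _ : ℝ => loFlowAction κ S₀ U)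
            (contDiff_const_family (contDiff_loFlowAction U κ S₀)) T 0 c (fun m => (η m : E)))))
            (fun _ => (1 : ℝ)))^[k] g) ω * Real.exp (-(c * esAction κ S₀ U (sphereTDFlow (G := fun _ : ℝ => loFlowAction κ S₀ U)
            (contDiff_const_family (contDiff_loFlowAction U κ S₀)) T 0 c (fun m => ((ω : Λ → sphere (0 : E) 1) m : E))) -
          sphereTDFlowLogJac (G := fun _ : ℝ => loFlowAction κ S₀ U)
            (contDiff_const_family (contDiff_loFlowAction U κ S₀)) T 0 c (fun m => (ω m : E))))
            ∂Measure.pi (fun _ : Λ => uniformSphere (volume : Measure E))) /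
          ∫ ω, g ω ^ 2 * Real.exp (-(c * esAction κ S₀ U (sphereTDFlow (G := fun _ : ℝ => loFlowAction κ S₀ U)
            (contDiff_const_family (contDiff_loFlowAction U κ S₀)) T 0 c (fun m => ((ω : Λ → sphere (0 : E) 1) m : E))) -
          sphereTDFlowLogJac (G := fun _ : ℝ => loFlowAction κ S₀ U)
            (contDiff_const_family (contDiff_loFlowAction U κ S₀)) T 0 c (fun m => (ω m : E)))) ∂Measure.pi (fun _ : Λ => uniformSphere (volume : Measure E))) ≤
      1 / 2 + 12 * (∫ ω, Real.exp (-2 * (c * esAction κ S₀ U (sphereTDFlow (G := fun _ : ℝ => loFlowAction κ S₀ U)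
            (contDiff_const_family (contDiff_loFlowAction U κ S₀)) T 0 c (fun m => ((ω : Λ → sphere (0 : E) 1) m : E))) -
          sphereTDFlowLogJac (G := fun _ : ℝ => loFlowAction κ S₀ U)
            (contDiff_const_family (contDiff_loFlowAction U κ S₀)) T 0 c (fun m => (ω m : E)))) ∂Measure.pi (fun _ : Λ => uniformSphere (volume : Measure E))) /
          (∫ ω, Real.exp (-(c * esAction κ S₀ U (sphereTDFlow (G := fun _ : ℝ => loFlowAction κ S₀ U)
            (contDiff_const_family (contDiff_loFlowAction U κ S₀)) T 0 c (fun m => ((ω : Λ → sphere (0 : E) 1) m : E))) -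
          sphereTDFlowLogJac (G := fun _ : ℝ => loFlowAction κ S₀ U)
            (contDiff_const_family (contDiff_loFlowAction U κ S₀)) T 0 c (fun m => (ω m : E)))) ∂Measure.pi (fun _ : Λ => uniformSphere (volume : Measure E))) ^ 2 :=
  indepSampler_sign_tauInt_sandwich (continuous_effAction_loFlow (U := U) κ S₀ c (T := T)) hgm hg1 hg0

set_option maxHeartbeats 400000 in
/-- **THE `τ_int` CEILING FROM THE EFFECTIVE-SAMPLE-SIZE FLOOR**: no self-coupling, adjoint pairs,
`d ≥ 2`, `0 ≤ c ≤ |T| + 1`; for every balanced sign observable `g` of the exact LO flow sampler,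
`τ_int(g) ≤ ½ + 12·exp((c²/2)·(2κ²/(d−1))·Σ_n(Σ_m‖U_nm‖)²)`. -/
theorem loFlow_sign_tauInt_le (hU0 : ∀ n, U n n = 0)
    (hUadj : ∀ m n (v w : E), ⟪U m n v, w⟫ = ⟪v, U n m w⟫) (hd : 2 ≤ Module.finrank ℝ E)
    (κ S₀ : ℝ) {c : ℝ} (hc0 : 0 ≤ c) (hc : c ≤ |T| + 1)
    {g : (Λ → sphere (0 : E) 1) → ℝ} (hgm : Measurable g) (hg1 : ∀ ω, g ω ^ 2 = 1)
    (hg0 : ∫ ω, g ω * Real.exp (-(c * esAction κ S₀ U (sphereTDFlow (G := fun _ : ℝ => loFlowAction κ S₀ U)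
            (contDiff_const_family (contDiff_loFlowAction U κ S₀)) T 0 c (fun m => ((ω : Λ → sphere (0 : E) 1) m : E))) -
          sphereTDFlowLogJac (G := fun _ : ℝ => loFlowAction κ S₀ U)
            (contDiff_const_family (contDiff_loFlowAction U κ S₀)) T 0 c (fun m => (ω m : E)))) ∂Measure.pi (fun _ : Λ => uniformSphere (volume : Measure E)) = 0) :
    tauInt (fun k => (∫ ω, g ω *
          ((imhOp (Measure.pi (fun _ : Λ => uniformSphere (volume : Measure E))) (fun η => Real.exp (-(c * esAction κ S₀ U (sphereTDFlow (G := fun _ : ℝ => loFlowAction κ S₀ U)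
            (contDiff_const_family (contDiff_loFlowAction U κ S₀)) T 0 c (fun m => ((η : Λ → sphere (0 : E) 1) m : E))) -
          sphereTDFlowLogJac (G := fun _ : ℝ => loFlowAction κ S₀ U)
            (contDiff_const_family (contDiff_loFlowAction U κ S₀)) T 0 c (fun m => (η m : E)))))
            (fun _ => (1 : ℝ)))^[k] g) ω * Real.exp (-(c * esAction κ S₀ U (sphereTDFlow (G := fun _ : ℝ => loFlowAction κ S₀ U)
            (contDiff_const_family (contDiff_loFlowAction U κ S₀)) T 0 c (fun m => ((ω : Λ → sphere (0 : E) 1) m : E))) -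
          sphereTDFlowLogJac (G := fun _ : ℝ => loFlowAction κ S₀ U)
            (contDiff_const_family (contDiff_loFlowAction U κ S₀)) T 0 c (fun m => (ω m : E))))
            ∂Measure.pi (fun _ : Λ => uniformSphere (volume : Measure E))) /
          ∫ ω, g ω ^ 2 * Real.exp (-(c * esAction κ S₀ U (sphereTDFlow (G := fun _ : ℝ => loFlowAction κ S₀ U)
            (contDiff_const_family (contDiff_loFlowAction U κ S₀)) T 0 c (fun m => ((ω : Λ → sphere (0 : E) 1) m : E))) -
          sphereTDFlowLogJac (G := fun _ : ℝ => loFlowAction κ S₀ U)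
            (contDiff_const_family (contDiff_loFlowAction U κ S₀)) T 0 c (fun m => (ω m : E)))) ∂Measure.pi (fun _ : Λ => uniformSphere (volume : Measure E))) ≤
      1 / 2 + 12 * Real.exp (c ^ 2 / 2 * (2 * κ ^ 2 / ((Module.finrank ℝ E : ℝ) - 1) * ∑ n, (∑ m, ‖U n m‖) ^ 2)) := by
  have hsand := (loFlow_sign_tauInt_sandwich (U := U) κ S₀ c (T := T) hgm hg1 hg0).2
  rw [mul_div_assoc] at hsand
  refine hsand.trans ?_
  have hess := sq_integral_loWeight_ge hU0 hUadj hd κ S₀ hc0 hc (T := T)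
  -- identify GEN-15's weights `w = e^{ℓ − cS}` with `e^{−S_eff}`
  have e1 : ∫ ω, Real.exp (sphereTDFlowLogJac (G := fun _ : ℝ => loFlowAction κ S₀ U)
            (contDiff_const_family (contDiff_loFlowAction U κ S₀)) T 0 c
            (fun m => ((ω : Λ → sphere (0 : E) 1) m : E)) -
          c * esAction κ S₀ U (sphereTDFlow (G := fun _ : ℝ => loFlowAction κ S₀ U)
            (contDiff_const_family (contDiff_loFlowAction U κ S₀)) T 0 c (fun m => (ω m : E)))) ∂Measure.pi (fun _ : Λ => uniformSphere (volume : Measure E)) =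
      ∫ ω, Real.exp (-(c * esAction κ S₀ U (sphereTDFlow (G := fun _ : ℝ => loFlowAction κ S₀ U)
            (contDiff_const_family (contDiff_loFlowAction U κ S₀)) T 0 c (fun m => ((ω : Λ → sphere (0 : E) 1) m : E))) -
          sphereTDFlowLogJac (G := fun _ : ℝ => loFlowAction κ S₀ U)
            (contDiff_const_family (contDiff_loFlowAction U κ S₀)) T 0 c (fun m => (ω m : E)))) ∂Measure.pi (fun _ : Λ => uniformSphere (volume : Measure E)) := by
    refine integral_congr_ae (ae_of_all _ fun ω => ?_)
    show Real.exp _ = Real.exp _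
    congr 1
    ring
  have e2 : ∫ ω, Real.exp (sphereTDFlowLogJac (G := fun _ : ℝ => loFlowAction κ S₀ U)
            (contDiff_const_family (contDiff_loFlowAction U κ S₀)) T 0 c
            (fun m => ((ω : Λ → sphere (0 : E) 1) m : E)) -
          c * esAction κ S₀ U (sphereTDFlow (G := fun _ : ℝ => loFlowAction κ S₀ U)
            (contDiff_const_family (contDiff_loFlowAction U κ S₀)) T 0 c (fun m => (ω m : E)))) ^ 2 ∂Measure.pi (fun _ : Λ => uniformSphere (volume : Measure E)) =
      ∫ ω, Real.exp (-2 * (c * esAction κ S₀ U (sphereTDFlow (G := fun _ : ℝ => loFlowAction κ S₀ U)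
            (contDiff_const_family (contDiff_loFlowAction U κ S₀)) T 0 c (fun m => ((ω : Λ → sphere (0 : E) 1) m : E))) -
          sphereTDFlowLogJac (G := fun _ : ℝ => loFlowAction κ S₀ U)
            (contDiff_const_family (contDiff_loFlowAction U κ S₀)) T 0 c (fun m => (ω m : E)))) ∂Measure.pi (fun _ : Λ => uniformSphere (volume : Measure E)) := by
    refine integral_congr_ae (ae_of_all _ fun ω => ?_)
    show Real.exp _ ^ 2 = Real.exp _
    rw [sq, ← Real.exp_add]
    congr 1
    ring
  rw [e1, e2] at hess
  have hFc : Continuous fun ω : Λ → sphere (0 : E) 1 => c * esAction κ S₀ U (sphereTDFlow (G := fun _ : ℝ => loFlowAction κ S₀ U)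
            (contDiff_const_family (contDiff_loFlowAction U κ S₀)) T 0 c (fun m => (ω m : E))) -
          sphereTDFlowLogJac (G := fun _ : ℝ => loFlowAction κ S₀ U)
            (contDiff_const_family (contDiff_loFlowAction U κ S₀)) T 0 c (fun m => (ω m : E)) :=
    continuous_effAction_loFlow (U := U) κ S₀ c (T := T)
  have hZpos : 0 < ∫ ω, Real.exp (-(c * esAction κ S₀ U (sphereTDFlow (G := fun _ : ℝ => loFlowAction κ S₀ U)
            (contDiff_const_family (contDiff_loFlowAction U κ S₀)) T 0 c (fun m => ((ω : Λ → sphere (0 : E) 1) m : E))) -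
          sphereTDFlowLogJac (G := fun _ : ℝ => loFlowAction κ S₀ U)
            (contDiff_const_family (contDiff_loFlowAction U κ S₀)) T 0 c (fun m => (ω m : E)))) ∂Measure.pi (fun _ : Λ => uniformSphere (volume : Measure E)) :=
    integral_exp_pos (integrable_pi_of_continuous _ (Real.continuous_exp.comp hFc.neg))
  have hZ2 : 0 < (∫ ω, Real.exp (-(c * esAction κ S₀ U (sphereTDFlow (G := fun _ : ℝ => loFlowAction κ S₀ U)
            (contDiff_const_family (contDiff_loFlowAction U κ S₀)) T 0 c (fun m => ((ω : Λ → sphere (0 : E) 1) m : E))) -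
          sphereTDFlowLogJac (G := fun _ : ℝ => loFlowAction κ S₀ U)
            (contDiff_const_family (contDiff_loFlowAction U κ S₀)) T 0 c (fun m => (ω m : E)))) ∂Measure.pi (fun _ : Λ => uniformSphere (volume : Measure E))) ^ 2 := pow_pos hZpos 2
  -- `∫e^{−2F}/(∫e^{−F})² ≤ e^{(c²/2)M}`
  have hratio : (∫ ω, Real.exp (-2 * (c * esAction κ S₀ U (sphereTDFlow (G := fun _ : ℝ => loFlowAction κ S₀ U)
            (contDiff_const_family (contDiff_loFlowAction U κ S₀)) T 0 c (fun m => ((ω : Λ → sphere (0 : E) 1) m : E))) -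
          sphereTDFlowLogJac (G := fun _ : ℝ => loFlowAction κ S₀ U)
            (contDiff_const_family (contDiff_loFlowAction U κ S₀)) T 0 c (fun m => (ω m : E)))) ∂Measure.pi (fun _ : Λ => uniformSphere (volume : Measure E))) /
          (∫ ω, Real.exp (-(c * esAction κ S₀ U (sphereTDFlow (G := fun _ : ℝ => loFlowAction κ S₀ U)
            (contDiff_const_family (contDiff_loFlowAction U κ S₀)) T 0 c (fun m => ((ω : Λ → sphere (0 : E) 1) m : E))) -
          sphereTDFlowLogJac (G := fun _ : ℝ => loFlowAction κ S₀ U)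
            (contDiff_const_family (contDiff_loFlowAction U κ S₀)) T 0 c (fun m => (ω m : E)))) ∂Measure.pi (fun _ : Λ => uniformSphere (volume : Measure E))) ^ 2 ≤
      Real.exp (c ^ 2 / 2 * (2 * κ ^ 2 / ((Module.finrank ℝ E : ℝ) - 1) * ∑ n, (∑ m, ‖U n m‖) ^ 2)) := by
    rw [div_le_iff₀ hZ2]
    calc ∫ ω, Real.exp (-2 * (c * esAction κ S₀ U (sphereTDFlow (G := fun _ : ℝ => loFlowAction κ S₀ U)
            (contDiff_const_family (contDiff_loFlowAction U κ S₀)) T 0 c (fun m => ((ω : Λ → sphere (0 : E) 1) m : E))) -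
          sphereTDFlowLogJac (G := fun _ : ℝ => loFlowAction κ S₀ U)
            (contDiff_const_family (contDiff_loFlowAction U κ S₀)) T 0 c (fun m => (ω m : E)))) ∂Measure.pi (fun _ : Λ => uniformSphere (volume : Measure E))
        = Real.exp (c ^ 2 / 2 * (2 * κ ^ 2 / ((Module.finrank ℝ E : ℝ) - 1) * ∑ n, (∑ m, ‖U n m‖) ^ 2)) * (Real.exp (-(c ^ 2 / 2 * (2 * κ ^ 2 / ((Module.finrank ℝ E : ℝ) - 1) * ∑ n, (∑ m, ‖U n m‖) ^ 2))) *
            ∫ ω, Real.exp (-2 * (c * esAction κ S₀ U (sphereTDFlow (G := fun _ : ℝ => loFlowAction κ S₀ U)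
            (contDiff_const_family (contDiff_loFlowAction U κ S₀)) T 0 c (fun m => ((ω : Λ → sphere (0 : E) 1) m : E))) -
          sphereTDFlowLogJac (G := fun _ : ℝ => loFlowAction κ S₀ U)
            (contDiff_const_family (contDiff_loFlowAction U κ S₀)) T 0 c (fun m => (ω m : E)))) ∂Measure.pi (fun _ : Λ => uniformSphere (volume : Measure E))) := by
          rw [← mul_assoc, ← Real.exp_add, add_neg_cancel, Real.exp_zero, one_mul]
      _ ≤ _ := mul_le_mul_of_nonneg_left hess (Real.exp_pos _).le
  linarith [mul_le_mul_of_nonneg_left hratio (by norm_num : (0 : ℝ) ≤ 12)]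

set_option maxHeartbeats 400000 in
/-- **THE `τ_int` CEILING FOR EVENTS**: no self-coupling, adjoint pairs, `d ≥ 2`, `0 ≤ c ≤ |T| + 1`; for
every measurable event `A` with target probability `p` (`p·∫e^{−S_eff}dπ̄ = ∫_A e^{−S_eff}dπ̄`,
`0 < p < 1`) of the exact LO flow sampler,
`τ_int(1_A) ≤ ½ + 12·(p∨(1−p))/(p∧(1−p))·exp((c²/2)·(2κ²/(d−1))·Σ_n(Σ_m‖U_nm‖)²)` — together with the
floor of the sequel `TorusLinkSignObservableTauInt`, a two-sided law for every sector indicator. -/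
theorem loFlow_event_tauInt_le (hU0 : ∀ n, U n n = 0)
    (hUadj : ∀ m n (v w : E), ⟪U m n v, w⟫ = ⟪v, U n m w⟫) (hd : 2 ≤ Module.finrank ℝ E)
    (κ S₀ : ℝ) {c : ℝ} (hc0 : 0 ≤ c) (hc : c ≤ |T| + 1)
    {A : Set (Λ → sphere (0 : E) 1)} (hA : MeasurableSet A) {p : ℝ} (hp0 : 0 < p) (hp1 : p < 1)
    (hpA : p * ∫ ω, Real.exp (-(c * esAction κ S₀ U (sphereTDFlow (G := fun _ : ℝ => loFlowAction κ S₀ U)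
            (contDiff_const_family (contDiff_loFlowAction U κ S₀)) T 0 c (fun m => ((ω : Λ → sphere (0 : E) 1) m : E))) -
          sphereTDFlowLogJac (G := fun _ : ℝ => loFlowAction κ S₀ U)
            (contDiff_const_family (contDiff_loFlowAction U κ S₀)) T 0 c (fun m => (ω m : E)))) ∂Measure.pi (fun _ : Λ => uniformSphere (volume : Measure E)) =
      ∫ ω in A, Real.exp (-(c * esAction κ S₀ U (sphereTDFlow (G := fun _ : ℝ => loFlowAction κ S₀ U)
            (contDiff_const_family (contDiff_loFlowAction U κ S₀)) T 0 c (fun m => ((ω : Λ → sphere (0 : E) 1) m : E))) -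
          sphereTDFlowLogJac (G := fun _ : ℝ => loFlowAction κ S₀ U)
            (contDiff_const_family (contDiff_loFlowAction U κ S₀)) T 0 c (fun m => (ω m : E)))) ∂Measure.pi (fun _ : Λ => uniformSphere (volume : Measure E))) :
    tauInt (fun k => (∫ ω, (A.indicator (fun _ => (1 : ℝ)) ω - p) *
          ((imhOp (Measure.pi (fun _ : Λ => uniformSphere (volume : Measure E))) (fun η => Real.exp (-(c * esAction κ S₀ U (sphereTDFlow (G := fun _ : ℝ => loFlowAction κ S₀ U)
            (contDiff_const_family (contDiff_loFlowAction U κ S₀)) T 0 c (fun m => ((η : Λ → sphere (0 : E) 1) m : E))) -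
          sphereTDFlowLogJac (G := fun _ : ℝ => loFlowAction κ S₀ U)
            (contDiff_const_family (contDiff_loFlowAction U κ S₀)) T 0 c (fun m => (η m : E)))))
            (fun _ => (1 : ℝ)))^[k] (fun ω => A.indicator (fun _ => (1 : ℝ)) ω - p)) ω *
            Real.exp (-(c * esAction κ S₀ U (sphereTDFlow (G := fun _ : ℝ => loFlowAction κ S₀ U)
            (contDiff_const_family (contDiff_loFlowAction U κ S₀)) T 0 c (fun m => ((ω : Λ → sphere (0 : E) 1) m : E))) -
          sphereTDFlowLogJac (G := fun _ : ℝ => loFlowAction κ S₀ U)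
            (contDiff_const_family (contDiff_loFlowAction U κ S₀)) T 0 c (fun m => (ω m : E)))) ∂Measure.pi (fun _ : Λ => uniformSphere (volume : Measure E))) /
          ∫ ω, (A.indicator (fun _ => (1 : ℝ)) ω - p) ^ 2 * Real.exp (-(c * esAction κ S₀ U (sphereTDFlow (G := fun _ : ℝ => loFlowAction κ S₀ U)
            (contDiff_const_family (contDiff_loFlowAction U κ S₀)) T 0 c (fun m => ((ω : Λ → sphere (0 : E) 1) m : E))) -
          sphereTDFlowLogJac (G := fun _ : ℝ => loFlowAction κ S₀ U)
            (contDiff_const_family (contDiff_loFlowAction U κ S₀)) T 0 c (fun m => (ω m : E)))) ∂Measure.pi (fun _ : Λ => uniformSphere (volume : Measure E))) ≤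
      1 / 2 + 12 * (max p (1 - p) / min p (1 - p)) * Real.exp (c ^ 2 / 2 * (2 * κ ^ 2 / ((Module.finrank ℝ E : ℝ) - 1) * ∑ n, (∑ m, ‖U n m‖) ^ 2)) := by
  have hFc : Continuous fun ω : Λ → sphere (0 : E) 1 => c * esAction κ S₀ U (sphereTDFlow (G := fun _ : ℝ => loFlowAction κ S₀ U)
            (contDiff_const_family (contDiff_loFlowAction U κ S₀)) T 0 c (fun m => (ω m : E))) -
          sphereTDFlowLogJac (G := fun _ : ℝ => loFlowAction κ S₀ U)
            (contDiff_const_family (contDiff_loFlowAction U κ S₀)) T 0 c (fun m => (ω m : E)) :=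
    continuous_effAction_loFlow (U := U) κ S₀ c (T := T)
  have hZpos : 0 < ∫ ω, Real.exp (-(c * esAction κ S₀ U (sphereTDFlow (G := fun _ : ℝ => loFlowAction κ S₀ U)
            (contDiff_const_family (contDiff_loFlowAction U κ S₀)) T 0 c (fun m => ((ω : Λ → sphere (0 : E) 1) m : E))) -
          sphereTDFlowLogJac (G := fun _ : ℝ => loFlowAction κ S₀ U)
            (contDiff_const_family (contDiff_loFlowAction U κ S₀)) T 0 c (fun m => (ω m : E)))) ∂Measure.pi (fun _ : Λ => uniformSphere (volume : Measure E)) :=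
    integral_exp_pos (integrable_pi_of_continuous _ (Real.continuous_exp.comp hFc.neg))
  have hZ2 : 0 < (∫ ω, Real.exp (-(c * esAction κ S₀ U (sphereTDFlow (G := fun _ : ℝ => loFlowAction κ S₀ U)
            (contDiff_const_family (contDiff_loFlowAction U κ S₀)) T 0 c (fun m => ((ω : Λ → sphere (0 : E) 1) m : E))) -
          sphereTDFlowLogJac (G := fun _ : ℝ => loFlowAction κ S₀ U)
            (contDiff_const_family (contDiff_loFlowAction U κ S₀)) T 0 c (fun m => (ω m : E)))) ∂Measure.pi (fun _ : Λ => uniformSphere (volume : Measure E))) ^ 2 := pow_pos hZpos 2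
  have hA0 : 0 < ∫ ω in A, Real.exp (-(c * esAction κ S₀ U (sphereTDFlow (G := fun _ : ℝ => loFlowAction κ S₀ U)
            (contDiff_const_family (contDiff_loFlowAction U κ S₀)) T 0 c (fun m => ((ω : Λ → sphere (0 : E) 1) m : E))) -
          sphereTDFlowLogJac (G := fun _ : ℝ => loFlowAction κ S₀ U)
            (contDiff_const_family (contDiff_loFlowAction U κ S₀)) T 0 c (fun m => (ω m : E)))) ∂Measure.pi (fun _ : Λ => uniformSphere (volume : Measure E)) := by
    rw [← hpA]; positivity
  have hA1 : ∫ ω in A, Real.exp (-(c * esAction κ S₀ U (sphereTDFlow (G := fun _ : ℝ => loFlowAction κ S₀ U)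
            (contDiff_const_family (contDiff_loFlowAction U κ S₀)) T 0 c (fun m => ((ω : Λ → sphere (0 : E) 1) m : E))) -
          sphereTDFlowLogJac (G := fun _ : ℝ => loFlowAction κ S₀ U)
            (contDiff_const_family (contDiff_loFlowAction U κ S₀)) T 0 c (fun m => (ω m : E)))) ∂Measure.pi (fun _ : Λ => uniformSphere (volume : Measure E)) <
      ∫ ω, Real.exp (-(c * esAction κ S₀ U (sphereTDFlow (G := fun _ : ℝ => loFlowAction κ S₀ U)
            (contDiff_const_family (contDiff_loFlowAction U κ S₀)) T 0 c (fun m => ((ω : Λ → sphere (0 : E) 1) m : E))) -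
          sphereTDFlowLogJac (G := fun _ : ℝ => loFlowAction κ S₀ U)
            (contDiff_const_family (contDiff_loFlowAction U κ S₀)) T 0 c (fun m => (ω m : E)))) ∂Measure.pi (fun _ : Λ => uniformSphere (volume : Measure E)) := by
    rw [← hpA]; nlinarith
  have hsand := (indepSampler_event_tauInt_sandwich hFc hA hA0 hA1).2
  have hpq : (∫ ω in A, Real.exp (-(c * esAction κ S₀ U (sphereTDFlow (G := fun _ : ℝ => loFlowAction κ S₀ U)
            (contDiff_const_family (contDiff_loFlowAction U κ S₀)) T 0 c (fun m => ((ω : Λ → sphere (0 : E) 1) m : E))) -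
          sphereTDFlowLogJac (G := fun _ : ℝ => loFlowAction κ S₀ U)
            (contDiff_const_family (contDiff_loFlowAction U κ S₀)) T 0 c (fun m => (ω m : E)))) ∂Measure.pi (fun _ : Λ => uniformSphere (volume : Measure E))) /
      (∫ ω, Real.exp (-(c * esAction κ S₀ U (sphereTDFlow (G := fun _ : ℝ => loFlowAction κ S₀ U)
            (contDiff_const_family (contDiff_loFlowAction U κ S₀)) T 0 c (fun m => ((ω : Λ → sphere (0 : E) 1) m : E))) -
          sphereTDFlowLogJac (G := fun _ : ℝ => loFlowAction κ S₀ U)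
            (contDiff_const_family (contDiff_loFlowAction U κ S₀)) T 0 c (fun m => (ω m : E)))) ∂Measure.pi (fun _ : Λ => uniformSphere (volume : Measure E))) = p := by
    rw [← hpA, mul_div_assoc, div_self hZpos.ne', mul_one]
  rw [hpq] at hsand
  refine hsand.trans ?_
  have hess := sq_integral_loWeight_ge hU0 hUadj hd κ S₀ hc0 hc (T := T)
  have e1 : ∫ ω, Real.exp (sphereTDFlowLogJac (G := fun _ : ℝ => loFlowAction κ S₀ U)
            (contDiff_const_family (contDiff_loFlowAction U κ S₀)) T 0 c
            (fun m => ((ω : Λ → sphere (0 : E) 1) m : E)) -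
          c * esAction κ S₀ U (sphereTDFlow (G := fun _ : ℝ => loFlowAction κ S₀ U)
            (contDiff_const_family (contDiff_loFlowAction U κ S₀)) T 0 c (fun m => (ω m : E)))) ∂Measure.pi (fun _ : Λ => uniformSphere (volume : Measure E)) =
      ∫ ω, Real.exp (-(c * esAction κ S₀ U (sphereTDFlow (G := fun _ : ℝ => loFlowAction κ S₀ U)
            (contDiff_const_family (contDiff_loFlowAction U κ S₀)) T 0 c (fun m => ((ω : Λ → sphere (0 : E) 1) m : E))) -
          sphereTDFlowLogJac (G := fun _ : ℝ => loFlowAction κ S₀ U)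
            (contDiff_const_family (contDiff_loFlowAction U κ S₀)) T 0 c (fun m => (ω m : E)))) ∂Measure.pi (fun _ : Λ => uniformSphere (volume : Measure E)) := by
    refine integral_congr_ae (ae_of_all _ fun ω => ?_)
    show Real.exp _ = Real.exp _
    congr 1
    ring
  have e2 : ∫ ω, Real.exp (sphereTDFlowLogJac (G := fun _ : ℝ => loFlowAction κ S₀ U)
            (contDiff_const_family (contDiff_loFlowAction U κ S₀)) T 0 c
            (fun m => ((ω : Λ → sphere (0 : E) 1) m : E)) -
          c * esAction κ S₀ U (sphereTDFlow (G := fun _ : ℝ => loFlowAction κ S₀ U)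
            (contDiff_const_family (contDiff_loFlowAction U κ S₀)) T 0 c (fun m => (ω m : E)))) ^ 2 ∂Measure.pi (fun _ : Λ => uniformSphere (volume : Measure E)) =
      ∫ ω, Real.exp (-2 * (c * esAction κ S₀ U (sphereTDFlow (G := fun _ : ℝ => loFlowAction κ S₀ U)
            (contDiff_const_family (contDiff_loFlowAction U κ S₀)) T 0 c (fun m => ((ω : Λ → sphere (0 : E) 1) m : E))) -
          sphereTDFlowLogJac (G := fun _ : ℝ => loFlowAction κ S₀ U)
            (contDiff_const_family (contDiff_loFlowAction U κ S₀)) T 0 c (fun m => (ω m : E)))) ∂Measure.pi (fun _ : Λ => uniformSphere (volume : Measure E)) := by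
    refine integral_congr_ae (ae_of_all _ fun ω => ?_)
    show Real.exp _ ^ 2 = Real.exp _
    rw [sq, ← Real.exp_add]
    congr 1
    ring
  rw [e1, e2] at hess
  have hratio : (∫ ω, Real.exp (-2 * (c * esAction κ S₀ U (sphereTDFlow (G := fun _ : ℝ => loFlowAction κ S₀ U)
            (contDiff_const_family (contDiff_loFlowAction U κ S₀)) T 0 c (fun m => ((ω : Λ → sphere (0 : E) 1) m : E))) -
          sphereTDFlowLogJac (G := fun _ : ℝ => loFlowAction κ S₀ U)
            (contDiff_const_family (contDiff_loFlowAction U κ S₀)) T 0 c (fun m => (ω m : E)))) ∂Measure.pi (fun _ : Λ => uniformSphere (volume : Measure E))) /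
          (∫ ω, Real.exp (-(c * esAction κ S₀ U (sphereTDFlow (G := fun _ : ℝ => loFlowAction κ S₀ U)
            (contDiff_const_family (contDiff_loFlowAction U κ S₀)) T 0 c (fun m => ((ω : Λ → sphere (0 : E) 1) m : E))) -
          sphereTDFlowLogJac (G := fun _ : ℝ => loFlowAction κ S₀ U)
            (contDiff_const_family (contDiff_loFlowAction U κ S₀)) T 0 c (fun m => (ω m : E)))) ∂Measure.pi (fun _ : Λ => uniformSphere (volume : Measure E))) ^ 2 ≤
      Real.exp (c ^ 2 / 2 * (2 * κ ^ 2 / ((Module.finrank ℝ E : ℝ) - 1) * ∑ n, (∑ m, ‖U n m‖) ^ 2)) := by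
    rw [div_le_iff₀ hZ2]
    calc ∫ ω, Real.exp (-2 * (c * esAction κ S₀ U (sphereTDFlow (G := fun _ : ℝ => loFlowAction κ S₀ U)
            (contDiff_const_family (contDiff_loFlowAction U κ S₀)) T 0 c (fun m => ((ω : Λ → sphere (0 : E) 1) m : E))) -
          sphereTDFlowLogJac (G := fun _ : ℝ => loFlowAction κ S₀ U)
            (contDiff_const_family (contDiff_loFlowAction U κ S₀)) T 0 c (fun m => (ω m : E)))) ∂Measure.pi (fun _ : Λ => uniformSphere (volume : Measure E))
        = Real.exp (c ^ 2 / 2 * (2 * κ ^ 2 / ((Module.finrank ℝ E : ℝ) - 1) * ∑ n, (∑ m, ‖U n m‖) ^ 2)) * (Real.exp (-(c ^ 2 / 2 * (2 * κ ^ 2 / ((Module.finrank ℝ E : ℝ) - 1) * ∑ n, (∑ m, ‖U n m‖) ^ 2))) *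
            ∫ ω, Real.exp (-2 * (c * esAction κ S₀ U (sphereTDFlow (G := fun _ : ℝ => loFlowAction κ S₀ U)
            (contDiff_const_family (contDiff_loFlowAction U κ S₀)) T 0 c (fun m => ((ω : Λ → sphere (0 : E) 1) m : E))) -
          sphereTDFlowLogJac (G := fun _ : ℝ => loFlowAction κ S₀ U)
            (contDiff_const_family (contDiff_loFlowAction U κ S₀)) T 0 c (fun m => (ω m : E)))) ∂Measure.pi (fun _ : Λ => uniformSphere (volume : Measure E))) := by
          rw [← mul_assoc, ← Real.exp_add, add_neg_cancel, Real.exp_zero, one_mul]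
      _ ≤ _ := mul_le_mul_of_nonneg_left hess (Real.exp_pos _).le
  have hcoef : 0 ≤ 12 * (max p (1 - p) / min p (1 - p)) := by
    have hq : 0 < 1 - p := by linarith
    have : 0 < min p (1 - p) := lt_min hp0 hq
    positivity
  linarith [mul_le_mul_of_nonneg_left hratio hcoef]

end LO

end Summit.Ventures.LatticeQCDFlow.Exactness

end
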